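import Literature.IUT.HodgeArakelov.BadPlaceSettingAtModelTate
import Literature.IUT.HodgeArakelov.BadPlaceSettingOfUnderlineProp21
import Literature.IUT.HodgeArakelov.MonoThetaProjectiveNaturalSystemAtModelTate
import Literature.AnabelianGeometry.EtaleTheta.Discharge.Sec2Cor219iAtModelChi
import HarnessLib

/-!
# [IUTchII] Prop. 2.1 — the `Π^tp_{Y̲_v}`-ROW is well defined AT THE [EtTh] STAGE-2 MODELS with NO binder, and
# [IUTchII] Prop. 1.5 (ii) at the Tate model modulo [EtTh] Cor. 2.18 (iv) surjectivity ALONE (proof-only; D-0079 K-L6)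

S. Mochizuki, *Inter-universal Teichmüller theory II*, kurims manuscript (Dec. 2020) §2, Prop. 2.1 pp. 64–65, §1
Prop. 1.5 (ii) p. 29 [claim: Mochizuki2012, status: disputed] (IUTchII §2 Prop 2.1, kurims p.65); S. Mochizuki, *The
étale theta function …*, Publ. RIMS **45** (2009) [EtTh], §1 p. 12 ("`Z`" discrete, the dual graph), Prop. 2.4 p. 38,
Cor. 2.18 (i), (iv) pp. 60–62 (PRIMS PDF pages) [cite: MochizukiEtTh2009, Prop 2.4 p.38].  Cell `abc-iut`, seat
abc-iut-w5-d233 (gen 5); third file of the K-L6 slice «`Sec2Hyps` bundle — genuine-instance constructions at the [EtTh]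
models» (after `BadPlaceSettingAtModelTate` p453435, `MonoThetaProjectiveNaturalSystemAtModelTate` p454733).
PROOF-ONLY: no definition, no instance, no new named fact; every input consumed BY NAME.

THE POINT.  abc-iut-w4-d034's `BadPlaceSettingOfUnderlineProp21` (ROUTE C) proves the `Y̲`-row of [IUTchII] Prop. 2.1
well defined at the print-level model `BadPlaceSetting.ofUnderline` modulo ONLY the compact-generation binder `hYuu`
(GAP-LEDGER G-L6d6-1: `Π^tp_{Y̲̲}` topologically generated by the compact subgroups of `Π^tp_{X̲̲}`).  At abc-iut-L2-t5's
stage-2 models `ThetaSetting.modelχq p i j hj` the whole of `Π^tp_Y = Ker(pr₂) ⋊ G_{ℚ_p}` is COMPACT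
(abc-iut-w5-d091's `isCompact_GtpY_modelχq`, `Sec2Cor219iAtModelChi`), so `hYuu` holds there trivially
(`hYuu_of_isCompact_GtpY`: `Π^tp_{Y̲̲} = Π^tp_Y ∩ Π^tp_{X̲̲}` is itself a compact subgroup of `Π^tp_{X̲̲}`).  Hence:
* `isTopCharacteristic_GtpY_subgroupOf_Huu_modelχq` — for EVERY étale-theta datum and EVERY choice `X̲̲` over
  `modelχq p i j hj`, `Π^tp_{Y̲̲}` is stable under every topological automorphism of `Π^tp_{X̲̲}` (the tree's
  `IsTopCharacteristic`, [EtTh] Def. 3.3; the `Y̲̲`-half of abc-iut-L6-t1's (H1) and the hypothesis of abc-iut-w4-d030's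
  `EtaleLevels.transitionsAreIsos_modelSystem`) — NO binder;
* `YL_eq_ofUnderline_modelχq` — the `Π^tp_{Y̲_v}`-row of Prop. 2.1 at the print-level bad-place setting
  `BadPlaceSetting.ofUnderline C μ hC hS hl hp2 hpl hζ hη` over `modelχq p i j hj` is well defined for EVERY
  `E, C, μ, hζ, η` (binders of the carrier only); `YL_eq_modelTate` — the same at the Tate model's carrier of record of
  `BadPlaceSettingAtModelTate` with NO binder at all (only `p`, odd prime `l`, `4l ∣ p − 1`, `μ`); the `Ÿ̲`-row stays
  modulo (H1) (`ModelTateCarriers.YL_eq_of_piYddCharacteristic_modelTate`, p453435);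
* `transitionsAreIsos_modelSystem_modelTate_of_cor218_iv_surjective` — II:Prop1.5(ii) for the natural system at the
  Tate model over a compatible cyclotome FAMILY `mods` (DATA), its topological input `IsTopCharacteristic` now a theorem,
  modulo the level-wise [EtTh] Cor. 2.18 (iv) surjectivity clause (F-0639 instance form) ALONE — the alternative
  residual to {Cor. 2.18 (i) at the chain levels, Cor. 2.19 (iii)} of p454451 / p454733.

HONEST LABEL: `modelχq` / `modelTate` are SEMI-SYNTHETIC models of the typed [EtTh] §1 interface (not the tempered
`π₁` of a curve): classical topological-group facts about the model and joint-satisfiability evidence for the typed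
binders; nothing of [IUTchII] (claim key `Mochizuki2012`, DISPUTED, D-0012) or [EtTh] is asserted; no side is taken on
[IUTchIII] Cor. 3.12; typed ≠ proved; nothing here says abc is proved or refuted.
-/

noncomputable section

namespace Literature.IUT.HodgeArakelov

open Literature.AnabelianGeometry.EtaleTheta Literature.AnabelianGeometry.SemiGraphs
open Literature.AnabelianGeometry.EtaleTheta.SettingModel
open scoped Literature.AnabelianGeometry.EtaleTheta

namespace ModelTateCarriers

/-! ## §1. Compact `Π^tp_Y` ⇒ the compact-generation binder and the `Y̲̲`-clause (every setting) -/

section Generic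

variable {p : ℕ} [Fact p.Prime] {D : Literature.AnabelianGeometry.EtaleTheta.ThetaSetting p}
  {E : D.EtaleThetaData} {l : ℕ} (C : E.DoubleUnderline l)

/-- If `Π^tp_Y` is compact then `Π^tp_{Y̲̲} = Π^tp_Y ∩ Π^tp_{X̲̲}` is a compact subgroup of `Π^tp_{X̲̲}` (`Π^tp_{X̲̲}` is open,
hence closed, in `Π^tp_X`). [cite: MochizukiEtTh2009, §1 p.12] -/
theorem isCompact_GtpY_subgroupOf_Huu_of_isCompact_GtpY (hcpt : IsCompact (D.GtpY : Set D.PiTemp)) :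
    IsCompact ((D.GtpY.subgroupOf C.Huu : Subgroup C.Huu) : Set C.Huu) := by
  refine Topology.IsInducing.subtypeVal.isCompact_iff.mpr ?_
  convert hcpt.inter_right (C.Huu.isClosed_of_isOpen C.isOpen_Huu) using 1
  ext y
  constructor
  · rintro ⟨x, hx, rfl⟩
    exact ⟨hx, x.2⟩
  · rintro ⟨hy, hyH⟩
    exact ⟨⟨y, hyH⟩, hy, rfl⟩

/-- **Compact `Π^tp_Y` ⇒ the compact-generation binder `hYuu` (G-L6d6-1) in its `X̲̲`-reading**: `Π^tp_{Y̲̲}` lies in the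
closure of the subgroup generated by the compact subgroups of `Π^tp_{X̲̲}` — being one of them.
[cite: MochizukiEtTh2009, §1 p.12] -/
theorem hYuu_of_isCompact_GtpY (hcpt : IsCompact (D.GtpY : Set D.PiTemp)) :
    D.GtpY.subgroupOf C.Huu ≤
      (Subgroup.closure {h : C.Huu | ∃ K : Subgroup C.Huu, IsCompact (K : Set C.Huu) ∧ h ∈ K}).topologicalClosure :=
  fun _ hh => Subgroup.le_topologicalClosure _
    (Subgroup.subset_closure ⟨D.GtpY.subgroupOf C.Huu, isCompact_GtpY_subgroupOf_Huu_of_isCompact_GtpY C hcpt, hh⟩)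

/-- **Compact `Π^tp_Y` ⇒ `Π^tp_{Y̲̲}` is characteristic in the topological group `Π^tp_{X̲̲}`** (the `Y̲̲`-clause of (H1) /
[EtTh] Prop. 2.4 for the pair `Π^tp_{Y̲̲} ⊆ Π^tp_{X̲̲}`), by abc-iut-L6-d6's `map_GtpY_subgroupOf_eq_of_compactlyGenerated`.
[cite: MochizukiEtTh2009, Prop 2.4 p.38] -/
theorem isTopCharacteristic_GtpY_subgroupOf_Huu_of_isCompact_GtpY (hcpt : IsCompact (D.GtpY : Set D.PiTemp)) :
    IsTopCharacteristic C.Huu (D.GtpY.subgroupOf C.Huu) :=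
  fun α => EtaleThetaDataOfSetting.map_GtpY_subgroupOf_eq_of_compactlyGenerated C (hYuu_of_isCompact_GtpY C hcpt) α

end Generic

/-! ## §2. At the stage-2 models `modelχq p i j hj`: NO binder -/

section StageTwo

variable (p : ℕ) [Fact p.Prime] (i j : ℤ) (hj : Even j)
  {E : (ThetaSetting.modelχq p i j hj).EtaleThetaData} {l : ℕ} (C : E.DoubleUnderline l) {N : ℕ+}
  (μ : (ThetaSetting.modelχq p i j hj).CyclotomeMod l N)
  (hC : (ThetaSetting.modelχq p i j hj).Compat) (hS : (ThetaSetting.modelχq p i j hj).Sec2Hyps)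
  (hl : l.Prime) (hp2 : p ≠ 2) (hpl : p ≠ l) (hζ : ∃ ζ : (ThetaSetting.modelχq p i j hj).K, IsPrimitiveRoot ζ (4 * l))
  {η : (C.thetaEnvData μ hC hS).PiYdd → MuN p N} (hη : η ∈ (C.thetaEnvData μ hC hS).thetaCocycles)

/-- **`Π^tp_{Y̲̲}` is characteristic in `Π^tp_{X̲̲}` at the stage-2 models, for EVERY `E` and EVERY `X̲̲`** — `Π^tp_Y` is compact
there (abc-iut-w5-d091 `isCompact_GtpY_modelχq`). [cite: MochizukiEtTh2009, Prop 2.4 p.38] -/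
theorem isTopCharacteristic_GtpY_subgroupOf_Huu_modelχq :
    IsTopCharacteristic C.Huu ((ThetaSetting.modelχq p i j hj).GtpY.subgroupOf C.Huu) :=
  isTopCharacteristic_GtpY_subgroupOf_Huu_of_isCompact_GtpY C (isCompact_GtpY_modelχq p i j hj)

/-- **The `Π^tp_{Y̲_v}`-row of [IUTchII] Prop. 2.1 is well defined at the print-level bad-place setting of the stage-2
models**, for every `E, C, μ, hζ, η` (the carrier's own binders; nothing else): any two Prop. 2.1 outputs over the same
topological group have the same `Π^tp_{Y̲_v}` — abc-iut-w4-d034's ROUTE C `YL_eq_of_compactlyGenerated'` with `hYuu` a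
theorem. [claim: Mochizuki2012, status: disputed] (IUTchII §2 Prop 2.1, kurims p.65) -/
theorem YL_eq_ofUnderline_modelχq {P : TopGroup.{0}}
    (T₁ T₂ : TemperedCoverings (BadPlaceSetting.ofUnderline C μ hC hS hl hp2 hpl hζ hη) P) : T₁.YL = T₂.YL :=
  TemperedCoverings.YL_eq_of_compactlyGenerated' C μ hC hS hl hp2 hpl hζ hη
    (hYuu_of_isCompact_GtpY C (isCompact_GtpY_modelχq p i j hj)) T₁ T₂

end StageTwo

/-! ## §3. At the Tate model's carrier of record: NO binder at all -/

section Tate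

variable (p : ℕ) [Fact p.Prime] (l : ℕ+) (hl : Odd (l : ℕ)) (hlp : (l : ℕ).Prime) (hdvd : 4 * (l : ℕ) ∣ p - 1)
  {N : ℕ+} (μ : (ThetaSetting.modelχq p 1 2 even_two).CyclotomeMod l N)

/-- **II:Prop2.1, `Π^tp_{Y̲_v}`-row, at the Tate model with NO binder** (only `p`, an odd prime `l` with `4l ∣ p − 1`, a
level and a cyclotome identification `μ`): over the bad-place setting of record of `BadPlaceSettingAtModelTate` any two
Prop. 2.1 outputs have the same `Π^tp_{Y̲_v}`; the `Ÿ̲`-row stays modulo (H1)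
(`YL_eq_of_piYddCharacteristic_modelTate`). [claim: Mochizuki2012, status: disputed] (IUTchII §2 Prop 2.1, kurims p.65) -/
theorem YL_eq_modelTate (P : TopGroup.{0}) :
    let C := (((kummerCoreχq p 1 2 even_two).toKummerDataOfSection SemidirectProduct.inr (continuous_inrχq p 1 2)
        (fun _ => rfl) (map_inr_GK_le_GtpY_modelχq' p 1 2 even_two)
        (map_inr_GKdd_le_GtpYdd_modelχq' p 1 2 even_two)).etaleThetaDataOfClass
        (etaDdχq p 1 2 even_two)).doubleUnderlineχqOfEtaRes p 1 2 l hl (eta_res_etaDdχq p 1 2 even_two l hl)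
    let B := BadPlaceSetting.ofUnderline C μ (compat_modelχq p 1 2 even_two)
        (ThetaSetting.modelχq_sec2Hyps p 1 2 even_two) hlp (ne_two_of_four_mul_dvd_pred p l.pos hdvd)
        (ne_of_four_mul_dvd_pred p l.pos hdvd) (exists_isPrimitiveRoot_K_modelχq p 1 2 even_two l.pos hdvd)
        (EtaleThetaDataOfSetting.modN_rootLift_mem_thetaCocycles C (compat_modelχq p 1 2 even_two)
          (ThetaSetting.modelχq_sec2Hyps p 1 2 even_two) μ)
    ∀ T₁ T₂ : TemperedCoverings B P, T₁.YL = T₂.YL := by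
  intro C B T₁ T₂
  exact YL_eq_ofUnderline_modelχq p 1 2 even_two C μ _ _ hlp _ _ _ _ T₁ T₂

variable (mods : ∀ M : ℕ+, (ThetaSetting.modelχq p 1 2 even_two).CyclotomeMod l M)
  (hmods : ∀ (M M' : ℕ+) (h : (M : ℕ) ∣ (M' : ℕ)) (x : (ThetaSetting.modelχq p 1 2 even_two).lDeltaTheta l),
    MuN.red p M M' h ((mods M').red x) = (mods M).red x)

/-- **II:Prop1.5(ii) for the natural system at the Tate model over a compatible cyclotome FAMILY, modulo [EtTh]
Cor. 2.18 (iv) surjectivity at the levels ALONE**: abc-iut-w4-d030's `EtaleLevels.transitionsAreIsos_modelSystem` with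
its topological input `IsTopCharacteristic Π^tp_{X̲̲} Π^tp_{Y̲̲}` a theorem (`isTopCharacteristic_GtpY_subgroupOf_Huu_modelχq`)
and `h15`, `L`, `hζ`, `hf`, `hZ` supplied as in `MonoThetaProjectiveNaturalSystemAtModelTate`; residual = the F-0639 instance
`∀ M, (levelData …).Cor218_iv_surjective` (compatible family `mods` = DATA; inhabited: abc-iut-L2-t8's
`modelχq_exists_cyclotomeMod_family`). [claim: Mochizuki2012, status: disputed] (IUTchII §1 Prop 1.5 (ii), kurims p.29) -/
theorem transitionsAreIsos_modelSystem_modelTate_of_cor218_iv_surjective :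
    let hC := compat_modelχq p 1 2 even_two
    let hS := ThetaSetting.modelχq_sec2Hyps p 1 2 even_two
    let K₀ := (kummerCoreχq p 1 2 even_two).toKummerDataOfSection SemidirectProduct.inr (continuous_inrχq p 1 2)
        (fun _ => rfl) (map_inr_GK_le_GtpY_modelχq' p 1 2 even_two) (map_inr_GKdd_le_GtpYdd_modelχq' p 1 2 even_two)
    let C := (K₀.etaleThetaDataOfClass (etaDdχq p 1 2 even_two)).doubleUnderlineχqOfEtaRes p 1 2 l hl
        (eta_res_etaDdχq p 1 2 even_two l hl)
    let h15 : Literature.AnabelianGeometry.EtaleTheta.ThetaSetting.Prop15iii _ hC :=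
      prop15iii_etaleThetaDataOfClass_etaDdχq p hC SemidirectProduct.inr
        (continuous_inrχq p 1 2) (fun _ => rfl) (map_inr_GK_le_GtpY_modelχq' p 1 2 even_two)
        (map_inr_GKdd_le_GtpYdd_modelχq' p 1 2 even_two)
    let L : C.CuspLabels := ⟨fun _ => ∅, fun _ => ∅, fun _ => rfl⟩
    let hO := ThetaSetting.modelχq_isEtThOrigin p 1 2 even_two
    let hYcl := hYcl_modelχq p 1 2 even_two
    let hp2 := ne_two_of_four_mul_dvd_pred p l.pos hdvd
    let hpl := ne_of_four_mul_dvd_pred p l.pos hdvd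
    let hζ := exists_isPrimitiveRoot_K_modelχq p 1 2 even_two l.pos hdvd
    let hZ : ∀ M : ℕ+, Nonempty (ModelCyclotomes.lDeltaQuot (C.rigidData (mods M) hC hS h15 L) ≃*
        Literature.IUT.HodgeTheaters.ZHat) := fun M =>
      ModelCyclotomes.nonempty_lDeltaQuot_rigidData_mulEquiv_zHat C (mods M) hC hS h15 L hO hYcl hlp.ne_zero
    let Sys := EtaleLevels.modelSystem C hC hS hlp hp2 hpl hζ mods (EtaleThetaDataOfSetting.rootLift C)
      (rootLift_mem_rootCocycles C hC) hmods h15 L hZ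
    ∀ _hlift : ∀ M : ℕ+, (EtaleLevels.levelData C hC hS mods M).Cor218_iv_surjective, Sys.transitionsAreIsos := by
  intro hC hS K₀ C h15 L hO hYcl hp2 hpl hζ hZ Sys hlift
  exact EtaleLevels.transitionsAreIsos_modelSystem C hC hS hlp hp2 hpl hζ mods _ _ hmods h15 L hZ
    (isTopCharacteristic_GtpY_subgroupOf_Huu_modelχq p 1 2 even_two C) hlift

end Tate

end ModelTateCarriers

end Literature.IUT.HodgeArakelov

end
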